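import Literature.Barriers.ResolutionOfSingularities.ResidualOrderUnboundedExample2
import HarnessLib

/-!
# Hauser–Perlega's second example: the arithmetic of the exponents and the infinite iteration

`Literature/Barriers/ResolutionOfSingularities/ResidualOrderUnboundedExample2Cycle.lean` —
assembly of the stages of `ResidualOrderUnboundedExample2.lean` into the infinite point blow-up
sequence of Hauser–Perlega's SECOND EXAMPLE [cite: HauserPerlega2019, §4] over a field of odd
characteristic `p = 2h + 1`. We start (cycle `c = 1`) from the starting equation (0) with
`d = p(p−1)/2 = hp`, `a = r = 0`, `b = s = 1`, `λ = 1`, `Q = 0`, `A = 1`, i.e.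
`F⁰ = x^{hp²} y^{(p³+1)/2 + (p²−1)/2} w^{p³} + x^{hp² + hp + (p²+1)/2} y^{(p³+1)/2} v^{q} w^{p³ − hp}`;
cycle `c` (with `d = c·hp`, `m = cp + 2h`, `q' = (h+1)(d' + p² − 1)`, `d' = (c+1)hp`) consists of the
`h + m + 3 + q'` point blow-ups (1), (2)×`h`, (3)×`m`, (4), (5), (6)×`q'`. The exceptional
exponents are carried as `p³·k + (explicit residue)` (`x ↔ p³k + hp²`, `y ↔ p³k + (p³+1)/2`,
`v ↔ p³k`, `w + d ↔ p³(k+1)`), and every arithmetic hypothesis of the stage theorems is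
discharged from polynomial identities in `h` (checked by `ring`) and the bounds
`0 < R < p³` for the residues `R ∈ {p², (p³+1)/2, p²(h+1), 2(p²−1)(h+1)/2·… }`. Along the whole
sequence `ord F ≥ p³` and the residual order is `≥ d = c·hp` during cycle `c`:
`hasDivergentPointBlowupSequence_odd`, the second conjunct of `HauserPerlega2019` — for EVERY
field of odd characteristic.
-/

noncomputable section

open MvPolynomial Finset

open scoped BigOperators

namespace Literature.Barriers.ResolutionOfSingularities

open Literature.AlgebraicGeometry.Resolution.Hauser2010

namespace HauserPerlega

namespace Example2

/-! ## The constants of the second example as polynomials in `h = (p−1)/2` -/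

/-- `p³` for `p = 2h + 1`. [cite: HauserPerlega2019, §4 Second example] -/
def P3 (h : ℕ) : ℕ := (2 * h + 1) ^ 3

/-- `p²`. [cite: HauserPerlega2019, §4 Second example] -/
def p2 (h : ℕ) : ℕ := (2 * h + 1) ^ 2

/-- `p(p−1)/2 = hp`. [cite: HauserPerlega2019, §4 Second example] -/
def hp (h : ℕ) : ℕ := h * (2 * h + 1)

/-- `(p³ − p²)/2 = hp²`, the residue of the exceptional `x`-exponent. [cite: HauserPerlega2019, §4 Second example] -/
def hp2 (h : ℕ) : ℕ := h * (2 * h + 1) ^ 2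

/-- `g = (p² − 1)/2 = hp + h`. [cite: HauserPerlega2019, §4 Second example] -/
def gg (h : ℕ) : ℕ := h * (2 * h + 1) + h

/-- `(p³ + 1)/2`, the residue of the exceptional `y`-exponent `bp³ − (p³−1)/2`.
[cite: HauserPerlega2019, §4 Second example] -/
def ry (h : ℕ) : ℕ := h * (2 * h + 1) ^ 2 + h * (2 * h + 1) + h + 1

/-- The residue `(h+1)(p²−1) + 1 = q + 1 − (h+1)d` of the `x`-exponent of the `A`-term.
[cite: HauserPerlega2019, §4 Second example] -/
def R0 (h : ℕ) : ℕ := 4 * h ^ 3 + 8 * h ^ 2 + 4 * h + 1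

/-- `d = c·hp` during cycle `c` (`c ≥ 1`; "`d` divisible by `p(p−1)/2`"). [cite: HauserPerlega2019, §4 Second example] -/
def dd (h c : ℕ) : ℕ := c * (h * (2 * h + 1))

/-- `q = (p+1)/2·(d + p² − 1) = (h+1)(d + 2g)`. [cite: HauserPerlega2019, §4 Second example] -/
def qq (h c : ℕ) : ℕ := (h + 1) * (dd h c + 2 * gg h)

/-- `m = 2d/(p−1) + p − 1 = cp + 2h`. [cite: HauserPerlega2019, §4 Second example] -/
def mm (h c : ℕ) : ℕ := c * (2 * h + 1) + 2 * h

/-- `d + p² − h = d' + (p²+1)/2`, the `x`-exponent of the `A`-term after blow-ups (2).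
[cite: HauserPerlega2019, §4 Second example (2)] -/
def xaF (h c : ℕ) : ℕ := dd h c + 4 * h ^ 2 + 3 * h + 1

/-! ## Arithmetic -/

section Arith

variable {h : ℕ}

/-- A multiple of `P` plus a residue `0 < R < P` is not a multiple of `P` (how the key monomials are seen not to be `p³`-th powers). [folklore] -/
theorem not_dvd_of_dvd_add_lt {P A R : ℕ} (hA : P ∣ A) (h0 : 0 < R) (hR : R < P) : ¬ P ∣ A + R :=
  fun h => absurd (Nat.le_of_dvd h0 ((Nat.dvd_add_right hA).mp h)) (not_le.mpr hR)

/-- `p³ = R₀ + (4h³ + 4h² + 2h)`. [folklore] -/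
theorem P3_eq_R0_add (h : ℕ) : P3 h = R0 h + (4 * h ^ 3 + 4 * h ^ 2 + 2 * h) := by
  unfold P3 R0; ring

/-- `R₀ < p³`. [folklore] -/
theorem R0_lt_P3 (h1 : 1 ≤ h) : R0 h < P3 h := by
  rw [P3_eq_R0_add]; have : 0 < 2 * h := by omega
  omega

/-- `0 < R₀`. [folklore] -/
theorem R0_pos (h : ℕ) : 0 < R0 h := by unfold R0; omega

/-- `2·(p³+1)/2 = p³ + 1`. [folklore] -/
theorem two_ry (h : ℕ) : 2 * ry h = P3 h + 1 := by unfold ry P3; ring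

/-- `0 < (p³+1)/2`. [folklore] -/
theorem ry_pos (h : ℕ) : 0 < ry h := by unfold ry; omega

/-- `(p³+1)/2 < p³`. [folklore] -/
theorem ry_lt_P3 (h1 : 1 ≤ h) : ry h < P3 h := by
  have := two_ry h; have : 1 < ry h := by unfold ry; nlinarith
  omega

/-- `p³ = p²(h+1) + p²h`. [folklore] -/
theorem P3_eq_p2_mul (h : ℕ) : P3 h = p2 h * (h + 1) + p2 h * h := by unfold P3 p2; ring

/-- `0 < p²`. [folklore] -/
theorem p2_pos (h : ℕ) : 0 < p2 h := by unfold p2; positivity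

/-- `p²(h+1) < p³`. [folklore] -/
theorem p2h1_lt_P3 (h1 : 1 ≤ h) : p2 h * (h + 1) < P3 h := by
  rw [P3_eq_p2_mul]; have := Nat.mul_pos (p2_pos h) (show 0 < h by omega); omega

/-- `p² < p³`. [folklore] -/
theorem p2_lt_P3 (h1 : 1 ≤ h) : p2 h < P3 h := by
  have := p2h1_lt_P3 h1; have := p2_pos h; nlinarith

/-- `hp² < p³`. [folklore] -/
theorem hp2_lt_P3 (h1 : 1 ≤ h) : hp2 h < P3 h := by
  have : hp2 h = p2 h * h := by unfold hp2 p2; ring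
  have := p2h1_lt_P3 h1; nlinarith [p2_pos h]

/-- `0 < hp`. [folklore] -/
theorem hp_pos (h1 : 1 ≤ h) : 0 < hp h := by unfold hp; positivity

/-- `hp ≤ p³`. [folklore] -/
theorem hp_le_P3 (h : ℕ) : hp h ≤ P3 h := by
  have : P3 h = hp h + (8 * h ^ 3 + 10 * h ^ 2 + 5 * h + 1) := by unfold P3 hp; ring
  omega

/-- `0 < d`. [folklore] -/
theorem dd_pos {c : ℕ} (h1 : 1 ≤ h) (hc : 1 ≤ c) : 0 < dd h c := by unfold dd; positivity

/-- `d' = d + hp`. [cite: HauserPerlega2019, §4 Second example ("d' = d + (p−1)/2·p")] -/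
theorem dd_succ (h c : ℕ) : dd h (c + 1) = dd h c + hp h := by unfold dd hp; ring

/-- `c ≤ d = c·hp` (so `d → ∞` with the cycle counter). [folklore] -/
theorem le_dd {c : ℕ} (h1 : 1 ≤ h) : c ≤ dd h c :=
  Nat.le_mul_of_pos_right c (hp_pos h1)

/-- `q + 1 = (h+1)d + R₀`. [cite: HauserPerlega2019, §4 Second example] -/
theorem qq_succ (h c : ℕ) : qq h c + 1 = (h + 1) * dd h c + R0 h := by unfold qq gg R0; ring

/-- `d + p² − h + h(p² + d) = q + 1`. [cite: HauserPerlega2019, §4 Second example (2)] -/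
theorem xaF_add (h c : ℕ) : xaF h c + h * (p2 h + dd h c) = qq h c + 1 := by
  unfold xaF p2 qq gg; ring

/-- `d + p² − h = d' + (p²+1)/2`. [cite: HauserPerlega2019, §4 Second example (2)] -/
theorem xaF_eq (h c : ℕ) : xaF h c = dd h (c + 1) + gg h + 1 := by unfold xaF dd gg; ring

/-- `p² = 2g + 1`. [folklore] -/
theorem p2_eq (h : ℕ) : p2 h = 2 * gg h + 1 := by unfold p2 gg; ring

/-- `p² = 4h² + 4h + 1`. [folklore] -/
theorem p2_eq' (h : ℕ) : p2 h = 4 * h ^ 2 + 4 * h + 1 := by unfold p2; ring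

/-- The `y`-exponent of the `λ`-term, `p³k + (p³+1)/2 + (p²−1)/2 = p²(pk + h + 1)`.
[cite: HauserPerlega2019, §4 Second example (1)] -/
theorem ry_add_gg (h kb : ℕ) : P3 h * kb + ry h + gg h = (2 * h + 1) ^ 2 * ((2 * h + 1) * kb + h + 1) := by
  unfold P3 ry gg; ring

/-- `hp² + p²(h+1) = p³`. [folklore] -/
theorem hp2_add (h : ℕ) : hp2 h + p2 h * (h + 1) = P3 h := by unfold hp2 p2 P3; ring

/-- `(p³+1)/2 + (p²−1)/2 = p²(h+1)`. [folklore] -/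
theorem ry_add_gg' (h : ℕ) : ry h + gg h = p2 h * (h + 1) := by unfold ry gg p2; ring

/-- `(p³+1)/2 = hp² + g + 1`. [folklore] -/
theorem ry_eq (h : ℕ) : ry h = hp2 h + gg h + 1 := by unfold ry hp2 gg; ring

/-- `R₀ = hp² + 4h² + 3h + 1`. [folklore] -/
theorem R0_eq (h : ℕ) : R0 h = hp2 h + 4 * h ^ 2 + 3 * h + 1 := by unfold R0 hp2; ring

end Arith

/-! ## The states -/

section Forms

variable {K : Type*} [CommRing K]

/-- State (0) of cycle `c` = state during the blow-ups (6) after `j` of them: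
`ShapeC` with `x ↔ p³kₐ + hp²`, `y ↔ p³k_b + (p³+1)/2`, `v ↔ p³k_r`, `w + d ↔ p³(k_s + 1)`.
[cite: HauserPerlega2019, §4 Second example (0), (6)] -/
def CForm (h c j : ℕ) (G : MvPolynomial (Fin 4) K) : Prop :=
  ∃ ka kb kr ks ew : ℕ, ew + dd h c = P3 h * (ks + 1) ∧
    ShapeC (dd h c) (gg h) j (P3 h * ka + hp2 h) (P3 h * kb + ry h) (P3 h * kr) ew G

/-- State after blow-up (1). [cite: HauserPerlega2019, §4 Second example (1)] -/
def S1Form (h c : ℕ) (G : MvPolynomial (Fin 4) K) : Prop :=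
  ∃ k ks ew : ℕ, ew + dd h c = P3 h * (ks + 1) ∧ Shape1' (dd h c) (p2 h) (qq h c) (P3 h * k) ew G

/-- State after `i` of the `x`-blow-ups (2) (`1 ≤ i ≤ h`): `x ↔ p³k + i p²`, the `A`-term at
`x`-offset `(d + p² − h) + r(p² + d)` with `r + i = h`. [cite: HauserPerlega2019, §4 Second example (2)] -/
def B2Form (h c i : ℕ) (G : MvPolynomial (Fin 4) K) : Prop :=
  ∃ k ks ew r : ℕ, ew + dd h c = P3 h * (ks + 1) ∧ r + i = h ∧
    ShapeB (dd h c) (p2 h) (P3 h * k + i * p2 h) 0 0 ew (xaF h c + r * (p2 h + dd h c)) G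

/-- State after `j` of the `v`-blow-ups (3): `x ↔ p³k + hp²`, `v ↔ jΔ`, the `B`-term at `v`-offset
`j(Δ + h)`, `Δ = |x^{d'+(p²+1)/2}A·M| − p³`. [cite: HauserPerlega2019, §4 Second example (3)] -/
def B3Form (h c j : ℕ) (G : MvPolynomial (Fin 4) K) : Prop :=
  ∃ k ks ew Δ : ℕ, ew + dd h c = P3 h * (ks + 1) ∧ Δ + P3 h = (P3 h * k + hp2 h) + xaF h c + ew ∧
    ShapeB (dd h c) (p2 h) (P3 h * k + hp2 h) (j * Δ) (j * (Δ + h)) ew (xaF h c) G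

/-- State after blow-up (4): `w + d' ↔ p³(k_s + 1)`. [cite: HauserPerlega2019, §4 Second example (4)] -/
def B4Form (h c : ℕ) (G : MvPolynomial (Fin 4) K) : Prop :=
  ∃ k ks ew : ℕ, ew + dd h (c + 1) = P3 h * (ks + 1) ∧
    ShapeB (dd h (c + 1)) (p2 h) (P3 h * k + hp2 h) 0 0 ew (xaF h c) G

end Forms

/-! ## The blow-ups, with their arithmetic discharged -/

section Steps

variable {K : Type*} [CommRing K] {h c : ℕ}

/-- Distributivity, as a rewriting rule for `omega`. [folklore] -/
theorem P3_mul_add (h a b : ℕ) : P3 h * (a + b) = P3 h * a + P3 h * b := by ring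

/-- Distributivity, as a rewriting rule for `omega`. [folklore] -/
theorem P3_mul_succ (h a : ℕ) : P3 h * (a + 1) = P3 h * a + P3 h := by ring

/-- **Blow-up (1)** on the states. [cite: HauserPerlega2019, §4 Second example (1)] -/
theorem s1Form_step [Fact (Nat.Prime (2 * h + 1))] [CharP K (2 * h + 1)] [IsDomain K]
    (h1 : 1 ≤ h) (hc : 1 ≤ c) {G : MvPolynomial (Fin 4) K} (hG : CForm h c (qq h c) G) :
    S1Form h c (blowupStep (P3 h) 0 (tOf4 {1, 2}) G) := by
  obtain ⟨ka, kb, kr, ks, ew, hw, hS⟩ := hG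
  have hd : 1 ≤ dd h c := dd_pos h1 hc
  have hqv : 1 ≤ qq h c := le_trans hd (by unfold qq; nlinarith)
  have hN : P3 h * kb + ry h + gg h = (2 * h + 1) ^ 2 * ((2 * h + 1) * kb + h + 1) := ry_add_gg h kb
  have hpN : ¬ (2 * h + 1) ∣ (2 * h + 1) * kb + h + 1 := by
    rw [add_assoc, Nat.dvd_add_right (dvd_mul_right _ _)]
    intro hdvd
    have := Nat.le_of_dvd (by omega) hdvd
    omega
  have hwd : (2 * h + 1) ^ 3 ∣ ew + dd h c := ⟨ks + 1, hw⟩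
  have hdeg : (P3 h * ka + hp2 h) + (P3 h * kb + ry h + gg h) + P3 h * kr + (ew + dd h c) =
      (2 * h + 1) ^ 3 * ((ka + kb + kr + ks + 1) + 1) := by
    rw [hw]; unfold P3 hp2 ry gg; ring
  have hA : (2 * h + 1) ^ 3 ∣ (2 * h + 1) ^ 3 * (ka + kb + kr + ks + 1) + qq h c + 1 →
      (2 * h + 1) ^ 3 ∣ ew → False := by
    intro h3 hew
    have hdvd_d : P3 h ∣ dd h c := (Nat.dvd_add_right hew).mp hwd
    have hid : (2 * h + 1) ^ 3 * (ka + kb + kr + ks + 1) + qq h c + 1 =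
        (P3 h * (ka + kb + kr + ks + 1) + (h + 1) * dd h c) + R0 h := by
      rw [add_assoc, qq_succ]; unfold P3; ring
    rw [hid] at h3
    exact not_dvd_of_dvd_add_lt (dvd_add (dvd_mul_right _ _) (hdvd_d.mul_left _)) (R0_pos h)
      (R0_lt_P3 h1) h3
  exact ⟨ka + kb + kr + ks + 1, ks, ew, hw,
    shape1'_of_shapeC (p := 2 * h + 1) hd hqv hN hpN rfl hwd hdeg hA hS⟩

/-- **First blow-up of (2)** on the states. [cite: HauserPerlega2019, §4 Second example (2)] -/
theorem b2Form_step_one (h1 : 1 ≤ h) (hc : 1 ≤ c) {G : MvPolynomial (Fin 4) K} (hG : S1Form h c G) :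
    B2Form h c 1 (blowupStep (P3 h) 0 (tOf4 ∅) G) := by
  obtain ⟨h', rfl⟩ : ∃ h', h = h' + 1 := ⟨h - 1, by omega⟩
  obtain ⟨k, ks, ew, hw, hS⟩ := hG
  have hd : 1 ≤ dd (h' + 1) c := dd_pos h1 hc
  have hmul := P3_mul_add (h' + 1) k ks
  have hmul' := P3_mul_succ (h' + 1) ks
  have hr : xaF (h' + 1) c + h' * (p2 (h' + 1) + dd (h' + 1) c) + (p2 (h' + 1) + dd (h' + 1) c) =
      qq (h' + 1) c + 1 := by
    rw [← xaF_add (h' + 1) c]; ring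
  refine ⟨k + ks, ks, ew, h', hw, rfl, ?_⟩
  refine shapeB_of_shape1' hd (p2_pos _) (p2_lt_P3 h1) ?_ ?_ ?_ hS
  · omega
  · omega
  · intro hx hew
    have hdvd_d : P3 (h' + 1) ∣ dd (h' + 1) c := (Nat.dvd_add_right hew).mp ⟨ks + 1, hw⟩
    have hid : P3 (h' + 1) * (k + ks) + 1 * p2 (h' + 1) +
        (xaF (h' + 1) c + h' * (p2 (h' + 1) + dd (h' + 1) c)) =
        (P3 (h' + 1) * (k + ks) + (h' + 1) * dd (h' + 1) c) + R0 (h' + 1) := by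
      unfold xaF p2 R0 dd; ring
    rw [hid] at hx
    exact not_dvd_of_dvd_add_lt (dvd_add (dvd_mul_right _ _) (hdvd_d.mul_left _)) (R0_pos _)
      (R0_lt_P3 h1) hx

/-- **Further blow-ups of (2)** on the states. [cite: HauserPerlega2019, §4 Second example (2)] -/
theorem b2Form_step (h1 : 1 ≤ h) {i : ℕ} (hi : i + 1 ≤ h) {G : MvPolynomial (Fin 4) K}
    (hG : B2Form h c i G) : B2Form h c (i + 1) (blowupStep (P3 h) 0 (tOf4 ∅) G) := by
  obtain ⟨k, ks, ew, r, hw, hr, hS⟩ := hG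
  obtain ⟨r', rfl⟩ : ∃ r', r = r' + 1 := ⟨r - 1, by omega⟩
  have hmul := P3_mul_add h k ks
  have hmul' := P3_mul_succ h ks
  refine ⟨k + ks, ks, ew, r', hw, by omega, ?_⟩
  have hx1 : (r' + 1) * (p2 h + dd h c) = r' * (p2 h + dd h c) + (p2 h + dd h c) := by ring
  have hx2 : (i + 1) * p2 h = i * p2 h + p2 h := by ring
  refine shapeB_xstep (p2_pos h) (p2_lt_P3 h1) ?_ ?_ ?_ ?_ hS
  · omega
  · omega
  · omega
  · intro hx _ hew
    have hdvd_d : P3 h ∣ dd h c := (Nat.dvd_add_right hew).mp ⟨ks + 1, hw⟩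
    have hh : h = r' + 1 + i := by omega
    have hid : P3 h * (k + ks) + (i + 1) * p2 h + (xaF h c + r' * (p2 h + dd h c)) =
        (P3 h * (k + ks) + (1 + r') * dd h c) + R0 h := by
      subst hh; unfold xaF p2 R0 dd P3; ring
    rw [hid] at hx
    exact not_dvd_of_dvd_add_lt (dvd_add (dvd_mul_right _ _) (hdvd_d.mul_left _)) (R0_pos _)
      (R0_lt_P3 h1) hx

/-- After the `h` blow-ups (2), the state is the start of (3). [cite: HauserPerlega2019, §4 Second example (2), (3)] -/
theorem b3Form_of_b2Form {G : MvPolynomial (Fin 4) K} (hG : B2Form h c h G) : B3Form h c 0 G := by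
  obtain ⟨k, ks, ew, r, hw, hr, hS⟩ := hG
  have hr0 : r = 0 := by omega
  subst hr0
  rw [zero_mul, add_zero, show h * p2 h = hp2 h from rfl] at hS
  have hmul' := P3_mul_succ h ks
  have hle : P3 h ≤ (P3 h * k + hp2 h) + xaF h c + ew := by unfold xaF; omega
  refine ⟨k, ks, ew, (P3 h * k + hp2 h) + xaF h c + ew - P3 h, hw, Nat.sub_add_cancel hle, ?_⟩
  simpa only [zero_mul] using hS

/-- **Blow-ups (3)** on the states. [cite: HauserPerlega2019, §4 Second example (3)] -/
theorem b3Form_step (h1 : 1 ≤ h) {j : ℕ} {G : MvPolynomial (Fin 4) K} (hG : B3Form h c j G) :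
    B3Form h c (j + 1) (blowupStep (P3 h) 2 (tOf4 ∅) G) := by
  obtain ⟨k, ks, ew, Δ, hw, hΔ, hS⟩ := hG
  refine ⟨k, ks, ew, Δ, hw, hΔ, ?_⟩
  have e1 : (j + 1) * Δ = j * Δ + Δ := by ring
  have e2 : (j + 1) * (Δ + h) = j * (Δ + h) + Δ + h := by ring
  have e3 := p2_eq' h
  have e4 : xaF h c = dd h c + 4 * h ^ 2 + 3 * h + 1 := rfl
  have hmul' := P3_mul_succ h ks
  refine shapeB_vstep (p2_pos h) (p2_lt_P3 h1) (by unfold xaF; omega) ?_ ?_ ?_ ?_ hS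
  · omega
  · omega
  · omega
  · intro hx _ hew
    have hdvd_d : P3 h ∣ dd h c := (Nat.dvd_add_right hew).mp ⟨ks + 1, hw⟩
    have hid : P3 h * k + hp2 h + xaF h c = (P3 h * k + dd h c) + R0 h := by
      rw [R0_eq, e4]; ring
    rw [hid] at hx
    exact not_dvd_of_dvd_add_lt (dvd_add (dvd_mul_right _ _) hdvd_d) (R0_pos _) (R0_lt_P3 h1) hx

/-- **Blow-up (4)** on the states, with the paper's computation (∗) of the new `w`-exponent
`s̃p³ − d'`. [cite: HauserPerlega2019, §4 Second example (4)] -/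
theorem b4Form_step (h1 : 1 ≤ h) {G : MvPolynomial (Fin 4) K} (hG : B3Form h c (mm h c) G) :
    B4Form h c (blowupStep (P3 h) 3 (tOf4 {2}) G) := by
  obtain ⟨k, ks, ew, Δ, hw, hΔ, hS⟩ := hG
  have hmul := P3_mul_add h k ks
  have hmul' := P3_mul_succ h ks
  have hΔ' : Δ = P3 h * (k + ks) + hp2 h + (4 * h ^ 2 + 3 * h + 1) := by
    unfold xaF at hΔ; omega
  refine ⟨k, c * ((2 * h + 1) * (k + ks) + h + 1) + (2 * h + 1) * (k + ks) + h, (mm h c + 1) * Δ,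
    ?_, ?_⟩
  · rw [hΔ']; unfold mm dd P3 hp2; ring
  have e1 : (mm h c + 1) * Δ = mm h c * Δ + Δ := by ring
  have e2 : mm h c * (Δ + h) = mm h c * Δ + mm h c * h := by ring
  have e3 : dd h (c + 1) + xaF h c = p2 h + mm h c * h + dd h c := by
    simp only [dd, xaF, p2, mm]; ring
  refine shapeB_wstep (p2_pos h) (p2_lt_P3 h1) (by unfold xaF; omega) ?_ ?_ ?_ ?_ hS
  · omega
  · omega
  · omega
  · intro hx hew'
    have hw' : (mm h c + 1) * Δ + dd h (c + 1) =
        P3 h * (c * ((2 * h + 1) * (k + ks) + h + 1) + (2 * h + 1) * (k + ks) + h + 1) := by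
      rw [hΔ']; unfold mm dd P3 hp2; ring
    have hdvd_d : P3 h ∣ dd h (c + 1) := (Nat.dvd_add_right hew').mp ⟨_, hw'⟩
    have hid : P3 h * k + hp2 h + xaF h c = (P3 h * k + dd h (c + 1)) + ry h := by
      rw [xaF_eq, ry_eq]; ring
    rw [hid] at hx
    exact not_dvd_of_dvd_add_lt (dvd_add (dvd_mul_right _ _) hdvd_d) (ry_pos _) (ry_lt_P3 h1) hx

/-- **Blow-up (5)** on the states. [cite: HauserPerlega2019, §4 Second example (5)] -/
theorem cForm_step (h1 : 1 ≤ h) {G : MvPolynomial (Fin 4) K} (hG : B4Form h c G) :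
    CForm h (c + 1) 0 (blowupStep (P3 h) 1 (tOf4 ∅) G) := by
  obtain ⟨k, ks, ew, hw, hS⟩ := hG
  have hd : 1 ≤ dd h (c + 1) := dd_pos h1 (by omega)
  have hmul := P3_mul_add h k ks
  have hmul' := P3_mul_succ h ks
  have e1 := xaF_eq h c
  have e2 := ry_eq h
  refine ⟨k, k + ks, 0, ks, ew, hw, ?_⟩
  rw [mul_zero]
  refine shapeC_of_shapeB hd (p2_eq h) (xaF_eq h c) ?_ ?_ ?_ ?_ hS
  · omega
  · omega
  · rw [add_assoc, ry_add_gg']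
    exact not_dvd_of_dvd_add_lt (dvd_mul_right _ _) (Nat.mul_pos (p2_pos h) (Nat.succ_pos h))
      (p2h1_lt_P3 h1)
  · exact not_dvd_of_dvd_add_lt (dvd_mul_right _ _) (ry_pos h) (ry_lt_P3 h1)

/-- **Blow-ups (6)** on the states (`d` of the current cycle counter `c ≥ 1`).
[cite: HauserPerlega2019, §4 Second example (6)] -/
theorem cForm_vstep (h1 : 1 ≤ h) (hc : 1 ≤ c) {j : ℕ} {G : MvPolynomial (Fin 4) K}
    (hG : CForm h c j G) : CForm h c (j + 1) (blowupStep (P3 h) 2 (tOf4 ∅) G) := by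
  obtain ⟨ka, kb, kr, ks, ew, hw, hS⟩ := hG
  have hmul' := P3_mul_succ h ks
  have e1 : P3 h * (kr + (ka + kb + ks + 1)) = P3 h * kr + P3 h * ka + P3 h * kb + P3 h * ks + P3 h := by
    ring
  have e2 : hp2 h + (ry h + gg h) = P3 h := by rw [ry_add_gg', hp2_add]
  refine ⟨ka, kb, kr + (ka + kb + ks + 1), ks, ew, hw, ?_⟩
  refine shapeC_vstep (dd_pos h1 hc) ?_ ?_ ?_ ?_ hS
  · omega
  · omega
  · rw [add_assoc, ry_add_gg']
    exact not_dvd_of_dvd_add_lt (dvd_mul_right _ _) (Nat.mul_pos (p2_pos h) (Nat.succ_pos h))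
      (p2h1_lt_P3 h1)
  · exact not_dvd_of_dvd_add_lt (dvd_mul_right _ _) (ry_pos h) (ry_lt_P3 h1)

end Steps

/-! ## The schedule of charts and the sequence -/

/-- Number of point blow-ups in cycle `c`: `1 + h + m + 1 + 1 + q'`. [cite: HauserPerlega2019, §4 Second example] -/
def len (h c : ℕ) : ℕ := h + mm h c + 3 + qq h (c + 1)

/-- The chart of the `i`-th blow-up of cycle `c`: (1) `x`-chart `y ↦ y+1, v ↦ v+1`; (2) `h` times
`x`-chart; (3) `m` times `v`-chart; (4) `w`-chart `v ↦ v+1`; (5) `y`-chart; (6) `v`-charts.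
[cite: HauserPerlega2019, §4 Second example (1)–(6)] -/
def chartAt (h c i : ℕ) : Fin 4 × Finset (Fin 4) :=
  if i = 0 then (0, {1, 2}) else if i ≤ h then (0, ∅) else if i ≤ h + mm h c then (2, ∅)
  else if i = h + mm h c + 1 then (3, {2}) else if i = h + mm h c + 2 then (1, ∅) else (2, ∅)

/-- Position `(cycle counter c ≥ 1, index in cycle)` of the `k`-th blow-up. [folklore] -/
def pos (h : ℕ) : ℕ → ℕ × ℕ
  | 0 => (1, 0)
  | k + 1 => if (pos h k).2 + 1 < len h (pos h k).1 then ((pos h k).1, (pos h k).2 + 1)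
      else ((pos h k).1 + 1, 0)

/-- The recursion of `pos`. [folklore] -/
theorem pos_succ (h k : ℕ) : pos h (k + 1) =
    if (pos h k).2 + 1 < len h (pos h k).1 then ((pos h k).1, (pos h k).2 + 1)
      else ((pos h k).1 + 1, 0) := rfl

variable (K : Type*) [CommRing K]

/-- The chart variable of the `k`-th blow-up. [cite: HauserPerlega2019, §4 Second example] -/
def jSched (h k : ℕ) : Fin 4 := (chartAt h (pos h k).1 (pos h k).2).1

/-- The translations of the `k`-th blow-up. [cite: HauserPerlega2019, §4 Second example] -/
def tSched (h k : ℕ) : Fin 4 → K := tOf4 (chartAt h (pos h k).1 (pos h k).2).2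

/-- The exceptional `w`-exponent `p³ − hp` of the starting polynomial (`s = 1`, `d = hp`).
[cite: HauserPerlega2019, §4 Second example (0)] -/
def ewStart (h : ℕ) : ℕ := P3 h - hp h

/-- The starting polynomial: the starting equation (0) with `d = hp`, `a = r = 0`, `b = s = 1`,
`λ = 1`, `Q = 0`, `A = 1` — `F⁰ = x^{hp²} y^{(p³+1)/2+(p²−1)/2} w^{p³} + x^{hp²+hp+(p²+1)/2} y^{(p³+1)/2} v^{q} w^{p³−hp}`.
[cite: HauserPerlega2019, §4 Second example (0)] -/
def F0 (h : ℕ) : MvPolynomial (Fin 4) K :=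
  monomial (V4 (hp2 h) (ry h + gg h) 0 (ewStart h + dd h 1)) 1 +
    monomial (V4 (hp2 h + dd h 1 + gg h + 1) (ry h) (qq h 1) (ewStart h)) 1

/-- The sequence `F^k` of the second example. [cite: HauserPerlega2019, §4 Second example] -/
def seq (h : ℕ) : ℕ → MvPolynomial (Fin 4) K := seqF (P3 h) (jSched h) (tSched K h) (F0 K h)

variable {K}

/-- `(p³ − hp) + d = p³` for `d = hp` (`s = 1`). [folklore] -/
theorem ewStart_add {h : ℕ} : ewStart h + dd h 1 = P3 h * (0 + 1) := by
  unfold ewStart dd; rw [one_mul, zero_add, mul_one, ← hp, Nat.sub_add_cancel (hp_le_P3 h)]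

/-- Coefficients of `F⁰`. [folklore] -/
theorem coeff_F0 [Nontrivial K] (h : ℕ) (e : Fin 4 →₀ ℕ) :
    coeff e (F0 K h) = (if V4 (hp2 h) (ry h + gg h) 0 (ewStart h + dd h 1) = e then 1 else 0) +
      (if V4 (hp2 h + dd h 1 + gg h + 1) (ry h) (qq h 1) (ewStart h) = e then 1 else 0) := by
  simp only [F0, coeff_add, coeff_monomial]

/-- `F⁰` is the state (0) of cycle `1`. [cite: HauserPerlega2019, §4 Second example (0)] -/
theorem cForm_F0 [Nontrivial K] {h : ℕ} (h1 : 1 ≤ h) : CForm (K := K) h 1 (qq h 1) (F0 K h) := by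
  refine ⟨0, 0, 0, 0, ewStart h, ewStart_add, ?_⟩
  simp only [mul_zero, zero_add]
  have hd : 0 < dd h 1 := dd_pos h1 le_rfl
  have hne : ¬ V4 (hp2 h + dd h 1 + gg h + 1) (ry h) (qq h 1) (ewStart h) =
      V4 (hp2 h) (ry h + gg h) 0 (ewStart h + dd h 1) := by
    rw [eq_V4_iff]; simp only [V4_apply_zero]; omega
  have hne' : ¬ V4 (hp2 h) (ry h + gg h) 0 (ewStart h + dd h 1) =
      V4 (hp2 h + dd h 1 + gg h + 1) (ry h) (0 + qq h 1) (ewStart h) := by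
    rw [eq_V4_iff]; simp only [V4_apply_zero]; omega
  refine ⟨?_, ?_, ?_⟩
  · intro e he
    rw [MvPolynomial.mem_support_iff, coeff_F0] at he
    by_cases h1' : V4 (hp2 h) (ry h + gg h) 0 (ewStart h + dd h 1) = e
    · exact Or.inl h1'.symm
    by_cases h2' : V4 (hp2 h + dd h 1 + gg h + 1) (ry h) (qq h 1) (ewStart h) = e
    · subst h2'; right; right; simp
    rw [if_neg h1', if_neg h2', add_zero] at he
    exact absurd rfl he
  · rw [coeff_F0, if_pos rfl, if_neg hne, add_zero]
    exact one_ne_zero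
  · rw [coeff_F0, if_neg hne', zero_add, if_pos (by rw [zero_add])]
    exact one_ne_zero

/-- `F⁰` is clean (no `8`-th power monomials). [cite: HauserPerlega2019, §4 First example (0)] -/
theorem isClean_F0 [Nontrivial K] {h : ℕ} (h1 : 1 ≤ h) : IsClean (P3 h) (F0 K h) := by
  intro e he
  rw [MvPolynomial.mem_support_iff, coeff_F0] at he
  have hx : ¬ P3 h ∣ hp2 h := fun hdvd => absurd (Nat.le_of_dvd (by unfold hp2; positivity) hdvd)
    (not_le.mpr (hp2_lt_P3 h1))
  have hy : ¬ P3 h ∣ ry h := fun hdvd => absurd (Nat.le_of_dvd (ry_pos h) hdvd) (not_le.mpr (ry_lt_P3 h1))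
  by_cases h1' : V4 (hp2 h) (ry h + gg h) 0 (ewStart h + dd h 1) = e
  · subst h1'; rw [isPthPowerExponent_fin4_iff]; simp only [V4_apply_zero]; exact fun hh => hx hh.1
  by_cases h2' : V4 (hp2 h + dd h 1 + gg h + 1) (ry h) (qq h 1) (ewStart h) = e
  · subst h2'; rw [isPthPowerExponent_fin4_iff]; simp only [V4_apply_one]; exact fun hh => hy hh.2.1
  rw [if_neg h1', if_neg h2', add_zero] at he
  exact absurd rfl he

/-- `F⁰ ≠ 0`. [folklore] -/
theorem F0_ne_zero [Nontrivial K] {h : ℕ} (h1 : 1 ≤ h) : F0 K h ≠ 0 := by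
  intro h0
  obtain ⟨_, _, _, _, _, _, _, hk1, _⟩ := cForm_F0 (K := K) h1
  rw [h0, coeff_zero] at hk1
  exact hk1 rfl

/-! ## The state after the `k`-th blow-up -/

/-- The state at position `i` of the cycle with counter `c`. [cite: HauserPerlega2019, §4 Second example] -/
def StateShape (h c i : ℕ) (G : MvPolynomial (Fin 4) K) : Prop :=
  if i = 0 then CForm h c (qq h c) G
  else if i = 1 then S1Form h c G
  else if i ≤ h + 1 then B2Form h c (i - 1) G
  else if i ≤ h + mm h c + 1 then B3Form h c (i - h - 1) G
  else if i = h + mm h c + 2 then B4Form h c G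
  else CForm h (c + 1) (i - (h + mm h c + 3)) G

section Unfold

variable {h c : ℕ} {G : MvPolynomial (Fin 4) K}

/-- The state at position `0` of a cycle. [folklore] -/
theorem stateShape_zero : StateShape h c 0 G ↔ CForm h c (qq h c) G := by
  unfold StateShape; rw [if_pos rfl]

/-- The state at position `1` of a cycle. [folklore] -/
theorem stateShape_one : StateShape h c 1 G ↔ S1Form h c G := by
  unfold StateShape; rw [if_neg (by decide), if_pos rfl]

/-- The state at positions `2, …, h+1` (blow-ups (2)). [folklore] -/
theorem stateShape_b2 {i : ℕ} (h2 : 2 ≤ i) (hi : i ≤ h + 1) : StateShape h c i G ↔ B2Form h c (i - 1) G := by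
  unfold StateShape; rw [if_neg (by omega), if_neg (by omega), if_pos hi]

/-- The state at positions `h+2, …, h+m+1` (blow-ups (3)). [folklore] -/
theorem stateShape_b3 {i : ℕ} (h2 : h + 2 ≤ i) (hi : i ≤ h + mm h c + 1) :
    StateShape h c i G ↔ B3Form h c (i - h - 1) G := by
  unfold StateShape; rw [if_neg (by omega), if_neg (by omega), if_neg (by omega), if_pos hi]

/-- The state at position `h+m+2` (after blow-up (4)). [folklore] -/
theorem stateShape_b4 : StateShape h c (h + mm h c + 2) G ↔ B4Form h c G := by
  unfold StateShape
  rw [if_neg (by omega), if_neg (by omega), if_neg (by omega), if_neg (by omega), if_pos rfl]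

/-- The state at positions `≥ h+m+3` (blow-ups (6), counted in the next cycle's `d`). [folklore] -/
theorem stateShape_c {i : ℕ} (hi : h + mm h c + 3 ≤ i) :
    StateShape h c i G ↔ CForm h (c + 1) (i - (h + mm h c + 3)) G := by
  unfold StateShape
  rw [if_neg (by omega), if_neg (by omega), if_neg (by omega), if_neg (by omega), if_neg (by omega)]

/-- Chart of blow-up (1). [folklore] -/
theorem chartAt_zero : chartAt h c 0 = (0, {1, 2}) := by unfold chartAt; rw [if_pos rfl]

/-- Chart of the blow-ups (2). [folklore] -/
theorem chartAt_x {i : ℕ} (h0 : 1 ≤ i) (hi : i ≤ h) : chartAt h c i = (0, ∅) := by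
  unfold chartAt; rw [if_neg (by omega), if_pos hi]

/-- Chart of the blow-ups (3). [folklore] -/
theorem chartAt_v {i : ℕ} (h0 : h + 1 ≤ i) (hi : i ≤ h + mm h c) : chartAt h c i = (2, ∅) := by
  unfold chartAt; rw [if_neg (by omega), if_neg (by omega), if_pos hi]

/-- Chart of blow-up (4). [folklore] -/
theorem chartAt_w : chartAt h c (h + mm h c + 1) = (3, {2}) := by
  unfold chartAt; rw [if_neg (by omega), if_neg (by omega), if_neg (by omega), if_pos rfl]

/-- Chart of blow-up (5). [folklore] -/
theorem chartAt_y : chartAt h c (h + mm h c + 2) = (1, ∅) := by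
  unfold chartAt
  rw [if_neg (by omega), if_neg (by omega), if_neg (by omega), if_neg (by omega), if_pos rfl]

/-- Chart of the blow-ups (6). [folklore] -/
theorem chartAt_v' {i : ℕ} (hi : h + mm h c + 3 ≤ i) : chartAt h c i = (2, ∅) := by
  unfold chartAt
  rw [if_neg (by omega), if_neg (by omega), if_neg (by omega), if_neg (by omega), if_neg (by omega)]

end Unfold

/-- **One blow-up** preserves the state description. [cite: HauserPerlega2019, §4 Second example] -/
theorem stateShape_step {h c i : ℕ} [Fact (Nat.Prime (2 * h + 1))] [CharP K (2 * h + 1)] [IsDomain K]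
    (h1 : 1 ≤ h) (hc : 1 ≤ c) {G : MvPolynomial (Fin 4) K} (hG : StateShape h c i G) :
    StateShape h c (i + 1) (blowupStep (P3 h) (chartAt h c i).1 (tOf4 (chartAt h c i).2) G) := by
  have hm : 1 ≤ mm h c := by unfold mm; omega
  rcases Nat.lt_or_ge i 1 with h0 | h0
  · have hi : i = 0 := by omega
    subst hi
    rw [stateShape_zero] at hG
    rw [chartAt_zero, stateShape_one]
    exact s1Form_step h1 hc hG
  rcases Nat.lt_or_ge i 2 with h2 | h2
  · have hi : i = 1 := by omega
    subst hi
    rw [stateShape_one] at hG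
    rw [chartAt_x le_rfl h1, stateShape_b2 le_rfl (by omega)]
    exact b2Form_step_one h1 hc hG
  rcases Nat.lt_or_ge i (h + 1) with h3 | h3
  · rw [stateShape_b2 h2 (by omega)] at hG
    rw [chartAt_x (by omega) (by omega), stateShape_b2 (by omega) (by omega),
      show i + 1 - 1 = (i - 1) + 1 by omega]
    exact b2Form_step h1 (by omega) hG
  rcases Nat.lt_or_ge i (h + 2) with h4 | h4
  · have hi : i = h + 1 := by omega
    subst hi
    rw [stateShape_b2 h2 le_rfl, show h + 1 - 1 = h by omega] at hG
    rw [chartAt_v le_rfl (by omega), stateShape_b3 le_rfl (by omega),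
      show h + 1 + 1 - h - 1 = 0 + 1 by omega]
    exact b3Form_step h1 (b3Form_of_b2Form hG)
  rcases Nat.lt_or_ge i (h + mm h c + 1) with h5 | h5
  · rw [stateShape_b3 h4 (by omega)] at hG
    rw [chartAt_v (by omega) (by omega), stateShape_b3 (by omega) (by omega),
      show i + 1 - h - 1 = (i - h - 1) + 1 by omega]
    exact b3Form_step h1 hG
  rcases Nat.lt_or_ge i (h + mm h c + 2) with h6 | h6
  · have hi : i = h + mm h c + 1 := by omega
    subst hi
    rw [stateShape_b3 h4 le_rfl, show h + mm h c + 1 - h - 1 = mm h c by omega] at hG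
    rw [chartAt_w, stateShape_b4]
    exact b4Form_step h1 hG
  rcases Nat.lt_or_ge i (h + mm h c + 3) with h7 | h7
  · have hi : i = h + mm h c + 2 := by omega
    subst hi
    rw [stateShape_b4] at hG
    rw [chartAt_y, stateShape_c le_rfl, Nat.sub_self]
    exact cForm_step h1 hG
  · rw [stateShape_c h7] at hG
    rw [chartAt_v' h7, stateShape_c (by omega),
      show i + 1 - (h + mm h c + 3) = (i - (h + mm h c + 3)) + 1 by omega]
    exact cForm_vstep h1 (by omega) hG

/-- **End of a cycle**: the state after the last blow-up (6) is the starting state of the next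
cycle. [cite: HauserPerlega2019, §4 Second example (6)] -/
theorem stateShape_wrap {h c : ℕ} {G : MvPolynomial (Fin 4) K} (hG : StateShape h c (len h c) G) :
    StateShape h (c + 1) 0 G := by
  rw [stateShape_c (by unfold len; omega)] at hG
  rw [stateShape_zero]
  rwa [show len h c - (h + mm h c + 3) = qq h (c + 1) by unfold len; omega] at hG

/-! ## The invariant along the sequence -/

/-- The cycle counter is `≥ 1`. [folklore] -/
theorem one_le_pos_fst (h k : ℕ) : 1 ≤ (pos h k).1 := by
  induction k with
  | zero => simp [pos]
  | succ k ih =>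
    rw [pos_succ]
    split_ifs
    · exact ih
    · exact Nat.le_add_left 1 _

/-- The position index stays below the cycle length. [folklore] -/
theorem pos_snd_lt (h k : ℕ) : (pos h k).2 < len h (pos h k).1 := by
  induction k with
  | zero => simp [pos, len]
  | succ k ih =>
    rw [pos_succ]
    split_ifs with hlt
    · exact hlt
    · simp [len]

/-- The `(k+1)`-st polynomial is the blow-up step of the `k`-th along the schedule. [folklore] -/
theorem seq_succ (h k : ℕ) : seq K h (k + 1) =
    blowupStep (P3 h) (chartAt h (pos h k).1 (pos h k).2).1 (tOf4 (chartAt h (pos h k).1 (pos h k).2).2)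
      (seq K h k) := rfl

/-- **The invariant.** [cite: HauserPerlega2019, §4 Second example] -/
theorem stateShape_seq {h : ℕ} [Fact (Nat.Prime (2 * h + 1))] [CharP K (2 * h + 1)] [IsDomain K]
    (h1 : 1 ≤ h) (k : ℕ) : StateShape h (pos h k).1 (pos h k).2 (seq K h k) := by
  induction k with
  | zero =>
    rw [show pos h 0 = (1, 0) from rfl, stateShape_zero]
    exact cForm_F0 h1
  | succ k ih =>
    have hlt := pos_snd_lt h k
    have hstep := stateShape_step h1 (one_le_pos_fst h k) ih
    rw [← seq_succ] at hstep
    rw [pos_succ]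
    split_ifs with hcase
    · exact hstep
    · have hi : (pos h k).2 + 1 = len h (pos h k).1 := by omega
      rw [hi] at hstep
      exact stateShape_wrap hstep

/-! ## Orders and residual orders from the states -/

/-- The bounds a state yields: `ord ≥ P` and the data of `le_residualOrder` for `N`. [folklore] -/
def Bnd (P N : ℕ) (G : MvPolynomial (Fin 4) K) : Prop :=
  (∀ e ∈ G.support, P ≤ e.degree) ∧
    ∃ mv : Fin 4 → ℕ, (∀ l, ∃ e ∈ G.support, e l ≤ mv l) ∧ ∀ e ∈ G.support, N + ∑ l, mv l ≤ e.degree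

/-- Weakening the residual bound. [folklore] -/
theorem Bnd.mono {P N N' : ℕ} {G : MvPolynomial (Fin 4) K} (hN : N' ≤ N) (hB : Bnd P N G) :
    Bnd P N' G := by
  obtain ⟨h1, mv, h2, h3⟩ := hB
  exact ⟨h1, mv, h2, fun e he => le_trans (by omega) (h3 e he)⟩

/-- Bounds from `ShapeC`: `ord ≥ P`, residual order `≥ d`. [folklore] -/
theorem bnd_of_shapeC {P d g j ex ey ev ew : ℕ} {G : MvPolynomial (Fin 4) K} (hP : P ≤ ew + d)
    (hS : ShapeC d g j ex ey ev ew G) : Bnd P d G := by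
  obtain ⟨hR, hk1, hk2⟩ := hS
  refine ⟨fun e he => ?_, ![ex, ey, ev, ew], ?_, fun e he => ?_⟩
  · have := hR e he; rw [eq_V4_iff] at this; rw [degree_fin4]; omega
  · rw [forall_fin4]
    exact ⟨⟨_, mem_support_iff.mpr hk1, by simp⟩, ⟨_, mem_support_iff.mpr hk2, by simp⟩,
      ⟨_, mem_support_iff.mpr hk1, by simp⟩, ⟨_, mem_support_iff.mpr hk2, by simp⟩⟩
  · have := hR e he; rw [eq_V4_iff] at this; rw [degree_fin4, Fin.sum_univ_four]
    simp only [Matrix.cons_val_zero, Matrix.cons_val_one, Matrix.cons_val]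
    omega

/-- Bounds from `Shape1'`: `ord ≥ P`, residual order `≥ d` (as `d ≤ q`). [folklore] -/
theorem bnd_of_shape1' {P d p2v qv ex ew : ℕ} {G : MvPolynomial (Fin 4) K} (hP : P ≤ ew + d)
    (hq : d ≤ qv) (hS : Shape1' d p2v qv ex ew G) : Bnd P d G := by
  obtain ⟨hR, hk1, hk2⟩ := hS
  refine ⟨fun e he => ?_, ![ex, 0, 0, ew], ?_, fun e he => ?_⟩
  · have := hR e he; rw [degree_fin4]; omega
  · rw [forall_fin4]
    exact ⟨⟨_, mem_support_iff.mpr hk1, by simp⟩, ⟨_, mem_support_iff.mpr hk2, by simp⟩,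
      ⟨_, mem_support_iff.mpr hk1, by simp⟩, ⟨_, mem_support_iff.mpr hk2, by simp⟩⟩
  · have := hR e he; rw [degree_fin4, Fin.sum_univ_four]
    simp only [Matrix.cons_val_zero, Matrix.cons_val_one, Matrix.cons_val]
    omega

/-- Bounds from `ShapeB`: `ord ≥ P`, residual order `≥ d` (as `d ≤ xa`). [folklore] -/
theorem bnd_of_shapeB {P d p2v ex ev vB ew xa : ℕ} {G : MvPolynomial (Fin 4) K} (hP : P ≤ ew + d)
    (hev : ev ≤ vB) (hxa : d ≤ xa) (hS : ShapeB d p2v ex ev vB ew xa G) : Bnd P d G := by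
  obtain ⟨hR, hk1, hk2⟩ := hS
  refine ⟨fun e he => ?_, ![ex, 0, ev, ew], ?_, fun e he => ?_⟩
  · have := hR e he; rw [degree_fin4]; omega
  · rw [forall_fin4]
    exact ⟨⟨_, mem_support_iff.mpr hk1, by simp⟩, ⟨_, mem_support_iff.mpr hk2, by simp⟩,
      ⟨_, mem_support_iff.mpr hk2, by simp⟩, ⟨_, mem_support_iff.mpr hk2, by simp⟩⟩
  · have := hR e he; rw [degree_fin4, Fin.sum_univ_four]
    simp only [Matrix.cons_val_zero, Matrix.cons_val_one, Matrix.cons_val]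
    omega

/-- `d ≤ d'`. [folklore] -/
theorem dd_mono (h c : ℕ) : dd h c ≤ dd h (c + 1) := by rw [dd_succ]; omega

/-- `d ≤ q`. [folklore] -/
theorem le_qq (h c : ℕ) : dd h c ≤ qq h c := by unfold qq; nlinarith

/-- Every state forces `ord F ≥ p³` and residual order `≥ d = c·hp`, for every exceptional set.
[cite: HauserPerlega2019, §4 Second example] -/
theorem bnd_of_stateShape {h c i : ℕ} (h1 : 1 ≤ h) {G : MvPolynomial (Fin 4) K}
    (hG : StateShape h c i G) : Bnd (P3 h) (dd h c) G := by
  have hm : 1 ≤ mm h c := by unfold mm; omega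
  unfold StateShape at hG
  split_ifs at hG with i0 i1 i2 i3 i4
  · obtain ⟨ka, kb, kr, ks, ew, hw, hS⟩ := hG
    exact bnd_of_shapeC (by rw [hw]; exact Nat.le_mul_of_pos_right _ (Nat.succ_pos _)) hS
  · obtain ⟨k, ks, ew, hw, hS⟩ := hG
    exact bnd_of_shape1' (by rw [hw]; exact Nat.le_mul_of_pos_right _ (Nat.succ_pos _)) (le_qq h c) hS
  · obtain ⟨k, ks, ew, r, hw, hr, hS⟩ := hG
    exact bnd_of_shapeB (by rw [hw]; exact Nat.le_mul_of_pos_right _ (Nat.succ_pos _)) le_rfl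
      (by unfold xaF; omega) hS
  · obtain ⟨k, ks, ew, Δ, hw, hΔ, hS⟩ := hG
    exact bnd_of_shapeB (by rw [hw]; exact Nat.le_mul_of_pos_right _ (Nat.succ_pos _))
      (Nat.mul_le_mul_left _ (Nat.le_add_right _ _)) (by unfold xaF; omega) hS
  · obtain ⟨k, ks, ew, hw, hS⟩ := hG
    refine Bnd.mono (dd_mono h c) (bnd_of_shapeB (by rw [hw]; exact Nat.le_mul_of_pos_right _ (Nat.succ_pos _))
      le_rfl (by rw [xaF_eq]; omega) hS)
  · obtain ⟨ka, kb, kr, ks, ew, hw, hS⟩ := hG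
    exact Bnd.mono (dd_mono h c)
      (bnd_of_shapeC (by rw [hw]; exact Nat.le_mul_of_pos_right _ (Nat.succ_pos _)) hS)

/-- **Along the whole sequence `ord F^k ≥ p³`.** [cite: HauserPerlega2019, §4 Second example] -/
theorem le_ordZero_seq {h : ℕ} [Fact (Nat.Prime (2 * h + 1))] [CharP K (2 * h + 1)] [IsDomain K]
    (h1 : 1 ≤ h) (k : ℕ) : (P3 h : ℕ∞) ≤ ordZero (seq K h k) :=
  le_ordZero_of_forall_mem_support (bnd_of_stateShape h1 (stateShape_seq h1 k)).1

/-- **The residual order after `k` blow-ups is `≥ d = c·hp`**, `c` the current cycle counter, for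
every exceptional set. [cite: HauserPerlega2019, §4 Second example] -/
theorem le_residualOrder_seq {h : ℕ} [Fact (Nat.Prime (2 * h + 1))] [CharP K (2 * h + 1)]
    [IsDomain K] (h1 : 1 ≤ h) (k : ℕ) (Δ : Finset (Fin 4)) :
    (dd h (pos h k).1 : ℕ∞) ≤ residualOrder Δ (seq K h k) := by
  obtain ⟨-, mv, hm, hN⟩ := bnd_of_stateShape h1 (stateShape_seq (K := K) h1 k)
  exact le_residualOrder Δ _ _ hm hN

/-! ## The cycle counter tends to infinity -/

/-- Index of the first blow-up of the cycle with counter `n + 1`. [folklore] -/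
def kStart (h : ℕ) : ℕ → ℕ
  | 0 => 0
  | n + 1 => kStart h n + len h (n + 1)

/-- Inside a cycle the position index counts up. [folklore] -/
theorem pos_add_of_pos_eq {h k c : ℕ} (hk : pos h k = (c, 0)) :
    ∀ i, i < len h c → pos h (k + i) = (c, i) := by
  intro i
  induction i with
  | zero => intro _; simpa using hk
  | succ i ih =>
    intro hi
    rw [← add_assoc, pos_succ, ih (by omega)]
    simp [hi]

/-- Cycles are non-empty. [folklore] -/
theorem one_le_len (h c : ℕ) : 1 ≤ len h c := by unfold len; omega

/-- Cycle `M` starts at blow-up number `kStart M`. [folklore] -/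
theorem pos_kStart (h n : ℕ) : pos h (kStart h n) = (n + 1, 0) := by
  induction n with
  | zero => rfl
  | succ n ih =>
    have hl := one_le_len h (n + 1)
    have hh := pos_add_of_pos_eq ih (len h (n + 1) - 1) (by omega)
    have heq : kStart h (n + 1) = kStart h n + (len h (n + 1) - 1) + 1 := by rw [kStart]; omega
    rw [heq, pos_succ, hh]
    simp only [show ¬ (len h (n + 1) - 1 + 1 < len h (n + 1)) by omega, if_false]

/-- The cycle index never decreases. [folklore] -/
theorem pos_fst_mono (h k : ℕ) : ∀ n, (pos h k).1 ≤ (pos h (k + n)).1 := by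
  intro n
  induction n with
  | zero => simp
  | succ n ih =>
    rw [← add_assoc, pos_succ]
    split_ifs
    · exact ih
    · exact ih.trans (Nat.le_succ _)

/-- After `kStart M` blow-ups we are in cycle `≥ M`. [folklore] -/
theorem le_pos_fst {h n k : ℕ} (hk : kStart h n ≤ k) : n + 1 ≤ (pos h k).1 := by
  obtain ⟨j, rfl⟩ := Nat.exists_eq_add_of_le hk
  have := pos_fst_mono h (kStart h n) j
  rw [pos_kStart] at this
  exact this

end Example2

/-- **Hauser–Perlega's second example, assembled**: for every odd prime `p = 2h + 1` and every
field `K` of characteristic `p` there is a point blow-up sequence with `pᵉ = p³`, `n = 4`,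
starting from the starting equation (0) with `d = p(p−1)/2`, along which `ord f` stays `p³` and
the residual order tends to infinity (it is `≥ c·p(p−1)/2` throughout the cycle with counter `c`).
This is the second conjunct of `HauserPerlega2019` (which asks it only for algebraically closed
fields). [cite: HauserPerlega2019, §1 and §4 Second example] -/
theorem hasDivergentPointBlowupSequence_odd (p : ℕ) (K : Type) [Field K] [CharP K p]
    (hp : p.Prime) (hp2 : p ≠ 2) : HasDivergentPointBlowupSequence p 3 4 K := by
  obtain ⟨h, rfl⟩ : ∃ h, p = 2 * h + 1 := by
    rcases hp.eq_two_or_odd with h2 | hodd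
    · exact absurd h2 hp2
    · exact ⟨p / 2, by omega⟩
  have h1 : 1 ≤ h := by have := hp.two_le; omega
  haveI : Fact (Nat.Prime (2 * h + 1)) := ⟨hp⟩
  refine ⟨Example2.seq K h, seqΔ Finset.univ (Example2.jSched h) (Example2.tSched K h),
    Example2.jSched h, Example2.tSched K h, ?_, ?_, ?_⟩
  · exact isPointBlowupSequence_seq _ (Example2.isClean_F0 h1) (Example2.le_ordZero_seq h1)
  · exact exists_nat_eq_residualOrder _ (Example2.F0_ne_zero h1)
  · intro N
    refine ⟨Example2.kStart h N, fun k hk => ?_⟩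
    have hle := Example2.le_residualOrder_seq (K := K) h1 k
      (seqΔ Finset.univ (Example2.jSched h) (Example2.tSched K h) k)
    have hc := Example2.le_pos_fst hk
    have hd := Example2.le_dd (c := (Example2.pos h k).1) h1
    refine lt_of_lt_of_le ?_ hle
    exact_mod_cast (show N < Example2.dd h (Example2.pos h k).1 by omega)


end HauserPerlega

end Literature.Barriers.ResolutionOfSingularities
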